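import Summits.CriticalPhenomena.Ising3D.Control2DReadoutCheck
import Summits.CriticalPhenomena.Ising3D.Control2DL15BoxUTable
import Mathlib.Tactic.NormNum
import HarnessLib

/-!
# Readout certificate B15: the spin-0 near-zero of the Λ = 15 lower-edge box functional sits at `Δ = 4.15` (`± 0.03`), displaced
from the 2D Ising level `T T̄ = 4` by `δ₀(15) = 0.15` — KERNEL (cell `pub-ising3x`, seat controls-1 gen 29; certificate kind "readout",
STRUCTURE.md §5 T-2 — CONTROL-ONLY)

HONEST FRAMING: lottery ticket; floor = tightest certified 3D Ising CFT bounds; no exact-solution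
claim without a proof. CONTROL-ONLY (`d = 2`, `Δ_σ = 1/8`, the 2D Ising control; axiom set `A2D′`); nothing about `d = 3`.
This is a statement about one of our INSTRUMENTS (a certified edge functional), not about a CFT.

Object: the kernel table `wtboxU` on `slL15` (RB-4 `j127796` (Λ = 15, E₀ = 40); box `[97/100, 39/40]`; the
typed functional `edgeB15` of `Control2DConjectureCF`). Claim, re-decided in the Lean kernel from exact rationals
(`Control2DReadoutCheck.readoutCheck`, `N = 160` `z`-series levels, the two-sided tail bound of `Control2DReadoutTail`):
the scalar-channel action `f(Δ) = φ[F^{1/8}_-[g_{Δ,0}]]` sampled at `Δ ∈ {4, 4.12, 4.15, 4.18}` is STRICTLY SMALLEST at `4.15`: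
`f(4.15) < f(a)`, `f(4.15) < f(b)`, `f(4.15) < f(4)` (`dip0_B15`) — exactly the body of the obligation node `CFDip15`
(closed by name in `Control2DConjectureCFHolds`). Certified margins of the check (lower-bound ratios `L(a)/U(m)`, `L(b)/2U(m)`,
`L(4)/U(m)` of the rational enclosures): 14.4 / 14.1 / 334. Zero grant compute. No facts, standard axioms only.
[cite: RattazziEtAl2008, §5.5]
-/

namespace Summit.CriticalPhenomena.Ising3D.Control2D

open Literature.MathematicalPhysics.QuantumFieldTheory.ConformalBootstrap3D

set_option maxHeartbeats 0 in
/-- The readout check of B15 PASSES in the kernel (`N = 160`; true level `4`, bracket `4.12, 4.15, 4.18`). [folklore] -/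
theorem readoutCheck_B15 : readoutCheck wtboxU slL15 15 160 4 (103 / 25) (83 / 20) (209 / 50) = true := by
  decide +kernel

set_option maxRecDepth 8192 in
/-- **Readout B15, kernel-complete**: for `φ = taylorFunctional2D (1/2) slL15 wtboxU` (`Δ_σ = 1/8`, scalar channel),
`f(4.15) < f(a)`, `f(4.15) < f(b)`, `f(4.15) < f(4)` with the bracket `a, b = 4.15 ∓ 0.03` — the near-zero is displaced ABOVE
`T T̄ = 4` by `δ₀(15) = 0.15 ± 0.03`. CONTROL-ONLY (d = 2). [cite: RattazziEtAl2008, §5.5] -/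
theorem dip0_B15 :
    taylorFunctional2D (1 / 2) slL15.toFinset (fun p => (wtboxU p : ℝ)) (crossF (1 / 8) (-1) (globalBlock (83 / 20) 0)) <
        taylorFunctional2D (1 / 2) slL15.toFinset (fun p => (wtboxU p : ℝ)) (crossF (1 / 8) (-1) (globalBlock (103 / 25) 0)) ∧
      taylorFunctional2D (1 / 2) slL15.toFinset (fun p => (wtboxU p : ℝ)) (crossF (1 / 8) (-1) (globalBlock (83 / 20) 0)) <
        taylorFunctional2D (1 / 2) slL15.toFinset (fun p => (wtboxU p : ℝ)) (crossF (1 / 8) (-1) (globalBlock (209 / 50) 0)) ∧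
      taylorFunctional2D (1 / 2) slL15.toFinset (fun p => (wtboxU p : ℝ)) (crossF (1 / 8) (-1) (globalBlock (83 / 20) 0)) <
        taylorFunctional2D (1 / 2) slL15.toFinset (fun p => (wtboxU p : ℝ)) (crossF (1 / 8) (-1) (globalBlock 4 0)) := by
  have h := dip0_of_readoutCheck wtboxU slL15_nodup slL15_deg readoutCheck_B15
  have e1 : ((83 / 20 : ℚ) : ℝ) = 83 / 20 := by norm_num
  have e2 : ((103 / 25 : ℚ) : ℝ) = 103 / 25 := by norm_num
  have e3 : ((209 / 50 : ℚ) : ℝ) = 209 / 50 := by norm_num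
  have e4 : ((4 : ℚ) : ℝ) = 4 := by norm_num
  rw [e1, e2, e3, e4] at h
  exact h

end Summit.CriticalPhenomena.Ising3D.Control2D
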